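import Literature.Computability.QuantumComplexity.BosonReductionMachine
import Literature.Computability.AlgebraicComplexity.PermanentCodeTranscoder
import Literature.Computability.Complexity.CanonicalCodes
import HarnessLib

/-!
# Exact BosonSampling: the validity test and the canonicaliser of matrix codes in `FP`

Family `quantum-advantage`; first of two brick files (with `BosonReductionPrecision.lean`) behind
the discharge of the book-keeping fact `bosonReduction_mem_FP` of `ExactBosonSamplingHardness.lean`
(`ExactBosonSamplingHardnessProofs.lean`; Aaronson–Arkhipov, *The computational complexity of
linear optics*, Theory of Computing 9 (2013), proof of Thm. 1.1, p. 178, and Lemma 4.4: "`U` can be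
computed in polynomial time given `X`"). The reduction maps `bosonPre` / `bosonCountPost` are
defined through `encodingIntMatrix.decode`, so a machine computing them must reproduce the
decoder's behaviour on *every* string: reject exactly the strings the decoder rejects, and
otherwise depend only on the decoded matrix. The total analysis of that decoder already exists in
`AlgebraicComplexity/PermanentCodeTranscoder.lean` (`encodingIntMatrix_decode`: the decoder accepts
exactly the strings satisfying `CodeOK` — row fuel = dimension header `codeDim`, every row with
that fuel — and then returns the matrix of the `intOfCode (codeEntry w i j)`; FP tests `chkDim`,
`chkRows`). On top of it and of the canonicalisation toolkit `CanonicalCodes.lean`, this file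
supplies what the machine of `BosonReductionMachine.lean` (values on canonical codes
`BosonFP.qcode M` only) needs:

* **the validity test** `validQF = andFn chkDim chkRows` with `validQF_apply : validQF w =
  [decide (CodeOK w)]` (one-bit, in `FP`);
* **the canonicaliser** `canonQF` (`Brick.canonF` for the header, `CanonCode.canonListFnC` twice
  over `CanonCode.canonIntFn` for the rows) with `canonQF_apply` / `canonQF_eq_qcode`: on a string
  satisfying `CodeOK`, `canonQF w = encodingIntMatrix.encode ⟨codeDim w, (intOfCode (codeEntry w · ·))⟩`,
  the canonical code of the decoded matrix.

## References

* S. Aaronson, A. Arkhipov, *The computational complexity of linear optics*, Theory of Computing 9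
  (2013), Lemma 4.4 and proof of Thm. 1.1 (p. 178).
* S. Arora, B. Barak, *Computational Complexity: A Modern Approach*, CUP 2009, §0.1 (codes of
  tuples and matrices), §1.3 (closure of polynomial time under composition and bounded loops).
-/

namespace Literature.Computability.QuantumComplexity

namespace BosonFP

open _root_.Computability Polynomial Literature.Computability.Complexity
  Literature.Computability.Complexity.OracleCompose Literature.Computability.Complexity.Brick
  Literature.Computability.Complexity.PRelSigPi Literature.Computability.Complexity.HashBricks
  Literature.Computability.Complexity.CanonCode BosonCodes
open Literature.Computability.AlgebraicComplexity (intOfCode encodingIntBool_decode codeDim codeFuel codeRows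
  codeEntry CodeOK encodingIntMatrix_decode chkDim chkRows chkDim_apply chkRows_apply chkDim_mem_FP chkRows_mem_FP
  oneBit_chkDim oneBit_chkRows)

/-! ### Canonical codes are valid -/

/-- A canonical matrix code satisfies `CodeOK`, with the announced dimension and entries. [folklore] -/
theorem codeOK_qcode {n : ℕ} (M : Fin n → Fin n → ℤ) :
    CodeOK (qcode M) ∧ (⟨codeDim (qcode M), fun i j => intOfCode (codeEntry (qcode M) i j)⟩ :
      Σ m : ℕ, Fin m → Fin m → ℤ) = ⟨n, M⟩ := by
  have hsome : encodingIntMatrix.decode (qcode M) = some ⟨n, M⟩ := encodingIntMatrix.decode_encode _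
  rw [encodingIntMatrix_decode] at hsome
  by_cases hv : CodeOK (qcode M)
  · rw [if_pos hv] at hsome
    exact ⟨hv, Option.some.inj hsome⟩
  · rw [if_neg hv] at hsome
    exact absurd hsome (by simp)

/-! ### The validity test in `FP` -/

/-- **The validity test** of a matrix code: the dimension test `chkDim` and the row test `chkRows`
of `PermanentCodeTranscoder.lean`, conjoined. [folklore] -/
noncomputable def validQF : List Bool → List Bool := andFn chkDim chkRows

/-- **Value of the validity test**: `[decide (CodeOK w)]`, the acceptance condition of
`encodingIntMatrix.decode` (`encodingIntMatrix_decode`). [folklore] -/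
@[simp] theorem validQF_apply (w : List Bool) : validQF w = [decide (CodeOK w)] := by
  rw [validQF, andFn_apply (chkDim_apply w) (chkRows_apply w)]
  congr 1
  rw [Bool.eq_iff_iff]
  simp only [Bool.and_eq_true, decide_eq_true_eq]
  unfold CodeOK
  constructor
  · rintro ⟨h1, h2⟩
    refine ⟨h1.symm, fun i hi => ?_⟩
    rw [h1]
    exact h2 i (h1 ▸ hi)
  · rintro ⟨h1, h2⟩
    refine ⟨h1.symm, fun i hi => ?_⟩
    rw [h1] at hi ⊢
    exact h2 i hi

/-- `validQF ∈ FP`. [folklore] -/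
theorem validQF_mem_FP : validQF ∈ FP := andFn_mem_FP chkDim_mem_FP chkRows_mem_FP

/-- The validity test is one-bit. [folklore] -/
theorem oneBit_validQF : OneBit validQF := fun w => ⟨_, validQF_apply w⟩

/-! ### The canonicaliser in `FP` -/

/-- The total list decoding `NegCNF.decList` (the value of the `listBool` decoders,
`CanonCode.canonListFnC_eq`) reads the items `elemOf`. [folklore] -/
theorem decList_eq_ofFn {α : Type} (d : List Bool → α) : ∀ (k : ℕ) (w : List Bool),
    NegCNF.decList d k w = List.ofFn fun j : Fin k => d (elemOf w j)
  | 0, _ => rfl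
  | k + 1, w => by
    rw [NegCNF.decList, decList_eq_ofFn d k, List.ofFn_succ]
    simp only [Fin.val_zero, elemOf_zero, Fin.val_succ, elemOf_succ]
    rfl

/-- The two total values of `encodingIntBool.decode` in the tree agree: `CanonCode.decInt = intOfCode`. [folklore] -/
theorem decInt_eq_intOfCode (v : List Bool) : decInt v = intOfCode v :=
  Option.some.inj ((decode_int v).symm.trans (encodingIntBool_decode v))

/-- Folding item codes with `boolPair` builds the nested-pair list `body`. [folklore] -/
theorem foldr_boolPair_eq_body {α : Type} (e : α → List Bool) : ∀ l : List α,
    l.foldr (fun a acc => boolPair (e a) acc) [] = body (l.map e)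
  | [] => rfl
  | a :: l => by rw [List.foldr_cons, foldr_boolPair_eq_body e l, List.map_cons, body_cons]

/-- The row canonicaliser: `encode ∘ decode` of `encodingIntBool.listBool` (`CanonCode.canonListFnC`
over `CanonCode.canonIntFn`). [folklore] -/
noncomputable def rowCanonF : List Bool → List Bool := canonListFnC 6 canonIntFn

/-- `|canonIntFn u| ≤ 1 · |u| + 5`. [folklore] -/
theorem length_canonIntFn_le' (u : List Bool) : (canonIntFn u).length ≤ 1 * u.length + 5 := by
  have := length_canonIntFn_le u; omega

/-- **Value of the row canonicaliser** on a row of fuel `m`: the canonical code of the row of the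
integers `intOfCode` of its first `m` entries. [folklore] -/
theorem rowCanonF_apply {m : ℕ} {u : List Bool} (h : (fstP u).length = m) :
    rowCanonF u = boolPair (ones m) (body (List.ofFn fun j : Fin m => intCode (intOfCode (elemOf (sndP u) j)))) := by
  have h1 := (canonListFnC_eq (C := 6) encodingIntBool decInt decode_int canonIntFn_eq length_canonIntFn_le'
    (by norm_num) u).2
  rw [rowCanonF, h1]
  change boolPair (unaryEncodeNat (NegCNF.decList decInt (fstP u).length (sndP u)).length)
    ((NegCNF.decList decInt (fstP u).length (sndP u)).foldr (fun a acc => boolPair (intCode a) acc) []) = _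
  rw [NegCNF.length_decList, h, foldr_boolPair_eq_body, decList_eq_ofFn, List.map_ofFn,
    OracleCompose.unaryEncodeNat_eq_replicate]
  simp only [Function.comp_def, decInt_eq_intOfCode]

/-- The row canonicaliser is linearly bounded: `|rowCanonF u| ≤ 8 |u| + 2`. [folklore] -/
theorem length_rowCanonF_le (u : List Bool) : (rowCanonF u).length ≤ 8 * u.length + 2 :=
  length_canonListFnC_le length_canonIntFn_le' (by norm_num) u

/-- `rowCanonF ∈ FP`. [folklore] -/
theorem rowCanonF_mem_FP : rowCanonF ∈ FP := canonListFnC_mem_FP 6 canonIntFn_mem_FP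

/-- **The canonicaliser of matrix codes**: `⟨canonical header, canonical row list⟩`. [folklore] -/
noncomputable def canonQF : List Bool → List Bool := fanoutFn (canonF ∘ fstF) (canonListFnC 10 rowCanonF ∘ sndF)

/-- `canonQF ∈ FP`. [folklore] -/
theorem canonQF_mem_FP : canonQF ∈ FP :=
  fanoutFn_mem_FP (comp_mem_FP canonF_mem_FP fstF_mem_FP)
    (comp_mem_FP (canonListFnC_mem_FP 10 rowCanonF_mem_FP) sndF_mem_FP)

/-- **Value of the canonicaliser on a string accepted by the decoder**: the canonical code of the
decoded matrix `⟨codeDim w, (intOfCode (codeEntry w · ·))⟩` (`encodingIntMatrix_decode`). [folklore] -/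
theorem canonQF_apply {w : List Bool} (h : CodeOK w) :
    canonQF w = encodingIntMatrix.encode ⟨codeDim w, fun i j => intOfCode (codeEntry w i j)⟩ := by
  obtain ⟨hk, hrows⟩ := h
  have hitems : itemsCanon rowCanonF (codeDim w) (codeRows w) =
      body (List.ofFn fun i : Fin (codeDim w) => boolPair (ones (codeDim w))
        (body (List.ofFn fun j : Fin (codeDim w) => intCode (intOfCode (codeEntry w i j))))) := by
    rw [itemsCanon_eq_frames, frames_eq_body, decList_eq_ofFn, List.map_ofFn]
    refine congrArg body (List.ofFn_inj.2 (funext fun i => ?_))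
    show rowCanonF (elemOf (codeRows w) i) = _
    rw [rowCanonF_apply (hrows i i.isLt)]
    rfl
  rw [encode_matrix_eq, canonQF, fanoutFn_apply, Function.comp_apply, Function.comp_apply,
    canonListFnC_apply length_rowCanonF_le (by norm_num), canonF_eq_encodeNat_decodeNat]
  change boolPair (encodeNat (codeDim w)) (boolPair (unaryEncodeNat (codeFuel w)) (itemsCanon rowCanonF (codeFuel w) (codeRows w))) = _
  rw [hk, hitems, OracleCompose.unaryEncodeNat_eq_replicate]

/-- **On a string accepted by the decoder the canonicaliser produces a canonical code** `qcode M` of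
the decoded matrix. [folklore] -/
theorem canonQF_eq_qcode {w : List Bool} (h : CodeOK w) :
    canonQF w = qcode (fun i j : Fin (codeDim w) => intOfCode (codeEntry w i j)) :=
  canonQF_apply h

end BosonFP

end Literature.Computability.QuantumComplexity
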